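import Summits.FinalStateConjecture.FinalStateConjecture.Theses.EIHFluxBalance
import Summits.FinalStateConjecture.FinalStateConjecture.Theorems.EIHFluxBalanceInertialRecessionStubQuasiStationarityReduction
import Summits.FinalStateConjecture.FinalStateConjecture.Theorems.EIHFluxBalanceInertialRecessionStubChargeModelUnpack

/-!
# Route EIHFluxBalance — `InertialRecession`, line `sublinear-is-free-clean-window-charges`,
# stub `stub_weightedQuasiStationarity` (= item stmt-FinalStateConjecture-16928): TRUE-FIELD
# QUASI-STATIONARITY DOES NOT SEE THE PAINTING (transfer between centre families and reference fields)

Helper file (`--supports stmt-FinalStateConjecture-10166`) of the worker on the registered stub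
`stub_weightedQuasiStationarity` (skeleton r11; = route item `WeightedQuasiStationarity`).

Companion of `…StubQS11TrueField` (QS for the modulated background ⟺ TFQS, true-field
quasi-stationarity: the `(1 + d^{7/4})`-weighted decay beyond every `ρ(t) → ∞` of the lab-time
derivative of the lab field `G + deviationExtend ⟨U, G, …⟩ Φ = Φ^* g`). TFQS mentions the painting in
two places only: the reference field `G` inside the lab field, and the centres `ξᵢ` inside the distance
`d(x) = ⨅ᵢ ‖x̲ − ξᵢ(t)‖` (region `d ≥ ρ(t)` and weight `1 + d^{7/4}`). This file removes both:

* `weight_le_of_le_add` — `1 + (d')^{7/4} ≤ (1 + (1+K)^{7/4})(1 + d^{7/4})` for `0 ≤ d' ≤ d + K`,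
  `1 ≤ d` (the weight written `1 + √(√(·⁷))` as in the crux);
* `iInf_norm_sub_sub_le` — centre families within `K` of each other have nearest-centre distances within
  `K` of each other;
* `lab_eq_and_fderiv_eq_of_domain_eq` — the lab field and its derivative on `U` do not depend on the
  reference field (both are `Φ^* g`);
* `trueField_transfer` — **TFQS transfers** from `(G, ξ)` to `(G', ξ')` for ARBITRARY reference fields
  `G, G' : E4 → (E4 →L E4 →L ℝ)` over the same chart `Φ : U → M` and centre families with
  `‖ξᵢ(t) − ξ'ᵢ(t)‖ ≤ K` eventually, granted only `0 < N` and the crux's domain clause for ONE painting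
  with centres `ξ` (so that far cone points lie in `U`, where both lab fields are the components of
  `Φ^* g`, cf. `LabMetric.bilin_add_deviationExtend_eq_pullbackBilin`).

Consequence (with `…StubQS11TrueField.quasiStationarity_iff_trueField` for each painting): if two
modulated multi-Kerr–Schild paintings `(M, a, Λ, ξ)` and `(M', a', Λ', ξ')` of the SAME lab chart both
satisfy the smoothness / domain / weighted-`C³` clauses of the crux antecedent and have `O(1)`-close
centres, then QS holds for one iff it holds for the other — whatever the masses, spins and boosts, and in
particular whatever the painted 4-velocity RATES. This is the kernel-checked form of the strategist's
remark (card `Lines/quasistationarity-is-the-rate.md`) that QS, unlike the per-hole rate hypothesis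
RATES_E0 (`t^{3/4}‖(Λᵢe₀)˙‖ → 0`, necessary for QS only for ONE isolated hole,
`…StubWeightedRatesNecessityQS`), is robust under admissible repainting (e.g. anti-correlated boost
jitter of tight partners): the stub is a statement about the vacuum development in the lab chart, and
the only route to it is a RATE for `∂ₜ(Φ^* g)`.

WHY TFQS IS THE HONEST RESIDUAL OF THE STUB (numbers, for the lead). Write `∂₀ lab = ∂₀G + ∂₀h` at a
cone point at clearance `R` from a group `g` of holes. By the landed kinematics
(`…StubQuasiStationarity{Bound,Reduction}`) everything in `∂₀G` except the 4-velocity-rate channel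
`Σᵢ Mᵢ𝒫ᵢ(x)u̇ᵢ/rᵢ` is rate-free and weighted `≤ C M d^{-1/4} → 0`, so QS needs exactly the
POINTWISE-in-`t` group rates `|Σ_{i∈g} Mᵢ𝒫ᵢu̇ᵢ| = o(R^{-3/4})` at every clearance scale up to `R ≍ t`.
The slab-local vacuum information in the tree does not supply them: (i) the pointwise equation
`Ric(lab) = 0` (`LabMetric.ricAt_bilin_add_deviationExtend_eq_zero`) gives
`|Ric_rate(G)| ≲ ε(t)R^{-7/4} + M²R^{-4}` (`ε(t)` = the weighted `C³` size of `h`, `M²R^{-4}` = the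
hole–hole cross terms), and the linearised Ricci of a monopole with painted 4-velocity `u(t)` contains
`u̇` only through the kernel `M u̇ x/R³` (in the trace-reversed form `h = (4M uu + 2Mη)/r` the `ü/r`
terms cancel, e.g. `R₀ᵢ ∋ ½(4Müᵢ/r − 4Müᵢ/r) = 0`), whence only `M|u̇| ≲ εR^{1/4} + M²R^{-2}` —
consistent with slaving (`u̇ → 0` from the near zone) but with no decay in `R`; (ii) the exact
moving-sphere law `dP/dt = −∮(−g)t_LL` (`…StubWindowCharges.stub_windowCharges`) bounds WINDOWED
increments, `|Σ_g Mᵢ(uᵢ(t+T) − uᵢ(t))| ≲ εR^{1/4} + M²/R + (flux)·T`, because reading `P` off `S_R`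
costs `R² · εR^{-7/4} = εR^{1/4}` (and the flux itself contains `(∂₀G)²R² ≍ M²|u̇|²` per unit time
unless QS is already known — this is where `…StubChargeModelWindowLawMain.windowLaw` consumes QS):
AVERAGE rates `≲ εR^{-3/4} + M²R^{-2}` over windows of length `T ≍ R`, never pointwise ones. The gap
"`u̇ → 0` and windowed averages `o(R^{-3/4})` ⇏ pointwise `o(t^{-3/4})`" (`u̇ = t^{-1/2}cos t` obeys
both, and slaving; cf. the witnesses of `…WeightedQuasiStationarity.Negative.KinematicShadow`) is closed
only by propagation / no-incoming-radiation content of the development: a pulse delivering momentum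
`M u̇` per unit time to a hole has `|∂h| ≍ (M u̇)^{1/2}/r` where it crosses the cone, and the `m = 1`
clause at `r ≍ t` then forces `M u̇ ≲ ε²t^{-3/2}` — a transport statement along the cone over lab times
`[t/(1+κ), t]`, not a slab statement. Hence the honest cut is TFQS itself, which an asymptotic-stability
theorem on the handoff side certifies directly (pointwise decay of `∂ₜ` of the constructed lab metric;
physically `∂₀ lab = O(M v d^{-2}) +` tail `O(t^{-3})` inside the cone, far below `d^{-7/4}`), and which
no Lorentz-group bookkeeping can replace.
-/

set_option linter.dupNamespace false
-- instance search on the nested operator spaces needs a deeper pending depth (as in `CoordCurvature.lean`)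
set_option maxSynthPendingDepth 3

noncomputable section

open scoped BigOperators Topology Manifold ContDiff ENNReal
open Filter Set Function TopologicalSpace Literature.Geometry.Lorentzian

namespace Summit.FinalStateConjecture.FinalStateConjecture.Theorems

namespace SublinearIsFree.TrueFieldQS

open Summit.FinalStateConjecture.FinalStateConjecture.Theorems.SublinearIsFree.QuasiStationarity

/-! ### Weights and nearest-centre distances under an `O(1)` change of the centres -/

/-- **Weight comparison**: for `1 ≤ d`, `0 ≤ K` and `0 ≤ d' ≤ d + K`,
`1 + √(√(d'⁷)) ≤ (1 + √(√((1+K)⁷))) · (1 + √(√(d⁷)))` (`d' ≤ (1+K)d`, and `√(√(·⁷))` is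
multiplicative and monotone). [folklore] -/
theorem weight_le_of_le_add {d d' K : ℝ} (hd : 1 ≤ d) (hK : 0 ≤ K) (hd'0 : 0 ≤ d')
    (hd' : d' ≤ d + K) :
    1 + √(√(d' ^ 7)) ≤ (1 + √(√((1 + K) ^ 7))) * (1 + √(√(d ^ 7))) := by
  have hd0 : 0 ≤ d := zero_le_one.trans hd
  have h1 : d' ≤ (1 + K) * d := by nlinarith
  have h2 : d' ^ 7 ≤ ((1 + K) * d) ^ 7 := pow_le_pow_left₀ hd'0 h1 7
  have h3 : √(√(d' ^ 7)) ≤ √(√((1 + K) ^ 7)) * √(√(d ^ 7)) := by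
    calc √(√(d' ^ 7)) ≤ √(√(((1 + K) * d) ^ 7)) := Real.sqrt_le_sqrt (Real.sqrt_le_sqrt h2)
      _ = √(√((1 + K) ^ 7)) * √(√(d ^ 7)) := by
          rw [mul_pow, Real.sqrt_mul (by positivity), Real.sqrt_mul (Real.sqrt_nonneg _)]
  have hA : 0 ≤ √(√((1 + K) ^ 7)) := Real.sqrt_nonneg _
  have hB : 0 ≤ √(√(d ^ 7)) := Real.sqrt_nonneg _
  nlinarith [mul_nonneg hA hB]

/-- **Nearest-centre distances move by at most the centres' displacement**: if `‖ξᵢ − ξ'ᵢ‖ ≤ K` for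
all `i` (`0 < N`), then `⨅ᵢ ‖y − ξ'ᵢ‖ − K ≤ ⨅ᵢ ‖y − ξᵢ‖`. [folklore] -/
theorem iInf_norm_sub_sub_le {N : ℕ} (hN : 0 < N) {y : E3} {ξ ξ' : Fin N → E3} {K : ℝ}
    (h : ∀ i, ‖ξ i - ξ' i‖ ≤ K) : (⨅ i, ‖y - ξ' i‖) - K ≤ ⨅ i, ‖y - ξ i‖ := by
  refine (WindowBounds.le_iInf_norm_sub_iff hN).2 fun i ↦ ?_
  have h1 : ⨅ j, ‖y - ξ' j‖ ≤ ‖y - ξ' i‖ := WindowBounds.iInf_norm_sub_le ξ' i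
  have h2 : ‖y - ξ' i‖ ≤ ‖y - ξ i‖ + ‖ξ i - ξ' i‖ := norm_sub_le_norm_sub_add_norm_sub y (ξ i) (ξ' i)
  linarith [h i]

/-- **The lab field and its derivative do not depend on the reference field.** For two reference
backgrounds over the SAME domain `U` (arbitrary reference fields `G, G'`, times, radii) and any chart
map `Φ : U → M`, the lab fields `G + deviationExtend ⟨U, G, …⟩ Φ` and `G' + deviationExtend ⟨U, G', …⟩ Φ`
agree on `U` (both are the components of `Φ^* g`) and therefore have the same derivative at every
point of the open set `U`. [folklore] -/
theorem lab_eq_and_fderiv_eq_of_domain_eq (𝓢 : Spacetime 4) (U : Opens E4)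
    (G G' : E4 → E4 →L[ℝ] E4 →L[ℝ] ℝ) (τ τ' r r' : E4 → ℝ) (Φ : U → 𝓢.carrier) {x : E4}
    (hx : x ∈ (U : Set E4)) :
    G x + 𝓢.deviationExtend (⟨U, G, τ, r⟩ : ModelBackground) Φ x =
        G' x + 𝓢.deviationExtend (⟨U, G', τ', r'⟩ : ModelBackground) Φ x ∧
      fderiv ℝ (fun y ↦ G y + 𝓢.deviationExtend (⟨U, G, τ, r⟩ : ModelBackground) Φ y) x =
        fderiv ℝ (fun y ↦ G' y + 𝓢.deviationExtend (⟨U, G', τ', r'⟩ : ModelBackground) Φ y) x := by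
  set B : ModelBackground := ⟨U, G, τ, r⟩ with hBdef
  set B' : ModelBackground := ⟨U, G', τ', r'⟩ with hB'def
  have hpt : ∀ z ∈ (U : Set E4), G z + 𝓢.deviationExtend B Φ z = G' z + 𝓢.deviationExtend B' Φ z := by
    intro z hz
    refine ContinuousLinearMap.ext fun v ↦ ContinuousLinearMap.ext fun w ↦ ?_
    have h1 := Spacetime.deviation_apply 𝓢 B Φ ⟨z, hz⟩ v w
    have h2 := Spacetime.deviation_apply 𝓢 B' Φ ⟨z, hz⟩ v w
    rw [add_apply, add_apply, add_apply, add_apply]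
    rw [show 𝓢.deviationExtend B Φ z = 𝓢.deviation B Φ ⟨z, hz⟩ from 𝓢.deviationExtend_coe B Φ ⟨z, hz⟩,
      show 𝓢.deviationExtend B' Φ z = 𝓢.deviation B' Φ ⟨z, hz⟩ from 𝓢.deviationExtend_coe B' Φ ⟨z, hz⟩,
      h1, h2]
    change G z v w + (_ - G z v w) = G' z v w + (_ - G' z v w)
    ring
  refine ⟨hpt x hx, Filter.EventuallyEq.fderiv_eq ?_⟩
  filter_upwards [U.2.mem_nhds hx] with z hz
  exact hpt z hz

/-! ### Transfer of true-field quasi-stationarity -/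

-- the algebraic and the operator-norm instance paths on `E4 →L[ℝ] E4 →L[ℝ] ℝ` unify slowly
set_option synthInstance.maxHeartbeats 400000 in
set_option maxHeartbeats 1600000 in
/-- **TFQS does not see the painting.** Let `Φ : U → M` be a chart map of a spacetime, `G, G'` ANY two
reference fields on `E4`, `ξ, ξ'` two families of `N ≥ 1` centre curves with `‖ξᵢ(t) − ξ'ᵢ(t)‖ ≤ K`
eventually, and assume the crux's domain clause for radii `rinᵢ ≥ 0`, spins `aᵢ`, frames `Λᵢ` and the
centres `ξ`. If the lab field `G + deviationExtend ⟨U, G, …⟩ Φ` is quasi-stationary at the weighted rate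
beyond every `ρ(t) → ∞` with distances measured from `ξ`, then the lab field
`G' + deviationExtend ⟨U, G', …⟩ Φ` is so with distances measured from `ξ'`. Proof: given `ρ' → ∞` read
the hypothesis with `ρ = ρ' − K`; eventually every cone point with `d'(x) ≥ ρ'(t)` has
`d(x) ≥ d'(x) − K ≥ ρ(t)` (`iInf_norm_sub_sub_le`), lies in `U` (as in `KSDecay.mem_domain_of_far`), where both
lab fields coincide near `x` (both are `Φ^* g`) and so do their derivatives, and its weight is at most
`(1 + (1+K)^{7/4})` times the unprimed one (`weight_le_of_le_add`). [folklore] -/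
theorem trueField_transfer (𝓢 : Spacetime 4) {N : ℕ} (hN : 0 < N)
    (G G' : E4 → E4 →L[ℝ] E4 →L[ℝ] ℝ) (a rin : Fin N → ℝ) (Λ : Fin N → ℝ → lorentzGroup)
    (ξ ξ' : Fin N → ℝ → E3) (κ τ₀ : ℝ) (U : Opens E4) (Φ : U → 𝓢.carrier)
    (hrin : ∀ i, 0 ≤ rin i)
    (hU : {x : E4 | τ₀ < x 0 ∧ ∀ i, rin i < Kerr.radius (a i)
      (poincareInv (Λ i (x 0)) (E4.ofTimeSpace (x 0) (ξ i (x 0))) x)} ⊆ (U : Set E4))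
    {K : ℝ} (hK : 0 ≤ K) (hclose : ∀ i, ∀ᶠ t in atTop, ‖ξ i t - ξ' i t‖ ≤ K)
    (hT : ∀ ρ : ℝ → ℝ, Tendsto ρ atTop atTop → Tendsto (fun t : ℝ ↦ ⨆ x ∈ {x : E4 | x 0 = t ∧
      E4.spatialNorm x ≤ κ * t ∧ ρ t ≤ ⨅ i, ‖E4.spatial x - ξ i t‖},
        ENNReal.ofReal (1 + √(√((⨅ i, ‖E4.spatial x - ξ i t‖) ^ 7))) *
          ‖fderiv ℝ (fun y : E4 ↦ G y + 𝓢.deviationExtend (⟨U, G, fun x ↦ x 0, E4.spatialNorm⟩ : ModelBackground) Φ y) x (E4.basisVector 0)‖ₑ) atTop (𝓝 0))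
    (ρ' : ℝ → ℝ) (hρ' : Tendsto ρ' atTop atTop) :
    Tendsto (fun t : ℝ ↦ ⨆ x ∈ {x : E4 | x 0 = t ∧ E4.spatialNorm x ≤ κ * t ∧ ρ' t ≤ ⨅ i, ‖E4.spatial x - ξ' i t‖},
      ENNReal.ofReal (1 + √(√((⨅ i, ‖E4.spatial x - ξ' i t‖) ^ 7))) *
        ‖fderiv ℝ (fun y : E4 ↦ G' y + 𝓢.deviationExtend (⟨U, G', fun x ↦ x 0, E4.spatialNorm⟩ : ModelBackground) Φ y) x (E4.basisVector 0)‖ₑ) atTop (𝓝 0) := by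
  set B : ModelBackground := ⟨U, G, fun x ↦ x 0, E4.spatialNorm⟩ with hBdef
  set B' : ModelBackground := ⟨U, G', fun x ↦ x 0, E4.spatialNorm⟩ with hB'def
  -- constants
  set C : ℝ := 1 + √(√((1 + K) ^ 7)) with hCdef
  have hC0 : 0 < C := by positivity
  set Amax : ℝ := ∑ i, (|a i| + rin i) with hAmax
  have hAi : ∀ i, |a i| + rin i ≤ Amax := fun i ↦
    Finset.single_le_sum (f := fun i ↦ |a i| + rin i) (fun i _ ↦ by have := hrin i; positivity)
      (Finset.mem_univ i)
  have hAmax0 : 0 ≤ Amax := Finset.sum_nonneg fun i _ ↦ by have := hrin i; positivity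
  -- the shifted threshold
  have hρ : Tendsto (fun t ↦ ρ' t - K) atTop atTop := tendsto_atTop_add_const_right _ (-K) hρ'
  refine tendsto_biSup_zero_of_eventually fun ε hε ↦ ?_
  have hεC : 0 < ε / C := div_pos hε hC0
  have hev : ∀ᶠ t in atTop, (1 + Amax ≤ ρ' t - K) ∧ τ₀ < t ∧ (∀ i, ‖ξ i t - ξ' i t‖ ≤ K) ∧
      (∀ x : E4, x 0 = t → E4.spatialNorm x ≤ κ * t → ρ' t - K ≤ ⨅ i, ‖E4.spatial x - ξ i t‖ →
        (1 + √(√((⨅ i, ‖E4.spatial x - ξ i t‖) ^ 7))) *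
          ‖fderiv ℝ (fun y : E4 ↦ G y + 𝓢.deviationExtend B Φ y) x (E4.basisVector 0)‖ ≤ ε / C) := by
    have h1 : ∀ᶠ t in atTop, 1 + Amax ≤ ρ' t - K := (tendsto_atTop.1 hρ) (1 + Amax)
    have h2 : ∀ᶠ t in atTop, τ₀ < t := eventually_gt_atTop τ₀
    have h3 : ∀ᶠ t in atTop, ∀ i, ‖ξ i t - ξ' i t‖ ≤ K := eventually_all.2 hclose
    have h4 := WindowBounds.quasiStationarity_pointwise (hT (fun t ↦ ρ' t - K) hρ) hεC
    filter_upwards [h1, h2, h3, h4] with t ht1 ht2 ht3 ht4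
    exact ⟨ht1, ht2, ht3, ht4⟩
  filter_upwards [hev] with t ht
  obtain ⟨hL, hτ, hKt, hQ⟩ := ht
  rintro x ⟨hx0, hxκ, hxρ⟩
  -- distances
  set d : ℝ := ⨅ i, ‖E4.spatial x - ξ i t‖ with hddef
  set d' : ℝ := ⨅ i, ‖E4.spatial x - ξ' i t‖ with hd'def
  have hd'0 : 0 ≤ d' := WindowBounds.iInf_norm_sub_nonneg _
  have hdd' : d' - K ≤ d := iInf_norm_sub_sub_le hN (y := E4.spatial x) fun i ↦ hKt i
  have hρd : ρ' t - K ≤ d := by linarith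
  have hd1 : 1 ≤ d := by linarith
  have hdi : ∀ i, d ≤ ‖E4.spatial x - ξ i t‖ := fun i ↦ WindowBounds.iInf_norm_sub_le (fun j ↦ ξ j t) i
  -- membership in the chart domain (the argument of `KSDecay.mem_domain_of_far`, inlined)
  have hxU : x ∈ (U : Set E4) := by
    refine hU ⟨by rw [hx0]; exact hτ, fun i ↦ ?_⟩
    have hsq := sq_sub_sq_le_radius_poincareInv_sq (Λ i (x 0)) (a i) (x 0) (ξ i (x 0)) (x := x) rfl
    have hr := Kerr.radius_nonneg (a i) (poincareInv (Λ i (x 0)) (E4.ofTimeSpace (x 0) (ξ i (x 0))) x)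
    have h1 : rin i + |a i| + 1 ≤ ‖E4.spatial x - ξ i (x 0)‖ := by
      rw [hx0]
      have h1 := hdi i
      have h2 := hAi i
      linarith
    have h2 : (rin i + |a i| + 1) ^ 2 ≤ ‖E4.spatial x - ξ i (x 0)‖ ^ 2 :=
      pow_le_pow_left₀ (by have := hrin i; positivity) h1 2
    refine lt_of_pow_lt_pow_left₀ 2 hr ?_
    nlinarith [abs_nonneg (a i), hrin i, sq_abs (a i)]
  -- the two lab fields have the same derivative at `x`
  have hfd : fderiv ℝ (fun y : E4 ↦ G' y + 𝓢.deviationExtend B' Φ y) x =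
      fderiv ℝ (fun y : E4 ↦ G y + 𝓢.deviationExtend B Φ y) x :=
    (lab_eq_and_fderiv_eq_of_domain_eq 𝓢 U G' G (fun x ↦ x 0) (fun x ↦ x 0) E4.spatialNorm
      E4.spatialNorm Φ hxU).2
  -- the weight comparison and the unprimed bound
  have hw : 1 + √(√(d' ^ 7)) ≤ C * (1 + √(√(d ^ 7))) := weight_le_of_le_add hd1 hK hd'0 (by linarith)
  have hq := hQ x hx0 hxκ hρd
  rw [ofReal_mul_enorm (by positivity)]
  refine ENNReal.ofReal_le_ofReal ?_
  rw [hfd]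
  have hn := norm_nonneg (fderiv ℝ (fun y : E4 ↦ G y + 𝓢.deviationExtend B Φ y) x (E4.basisVector 0))
  calc (1 + √(√(d' ^ 7))) * ‖fderiv ℝ (fun y : E4 ↦ G y + 𝓢.deviationExtend B Φ y) x (E4.basisVector 0)‖
      ≤ C * (1 + √(√(d ^ 7))) *
          ‖fderiv ℝ (fun y : E4 ↦ G y + 𝓢.deviationExtend B Φ y) x (E4.basisVector 0)‖ :=
        mul_le_mul_of_nonneg_right hw hn
    _ = C * ((1 + √(√(d ^ 7))) *
          ‖fderiv ℝ (fun y : E4 ↦ G y + 𝓢.deviationExtend B Φ y) x (E4.basisVector 0)‖) := by ring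
    _ ≤ C * (ε / C) := mul_le_mul_of_nonneg_left hq hC0.le
    _ = ε := mul_div_cancel₀ ε hC0.ne'

end SublinearIsFree.TrueFieldQS

/-- Registered sub-goal form (stub `iInf_norm_sub_sub_le_qs11` of the crux item; carrier of this file,
whose content `SublinearIsFree.TrueFieldQS.trueField_transfer` — true-field quasi-stationarity transfers
between arbitrary reference fields and `O(1)`-close centre families — has a statement exceeding the
stub-signature size limit) of `SublinearIsFree.TrueFieldQS.iInf_norm_sub_sub_le`: nearest-centre
distances move by at most the displacement of the centres. [folklore] -/
theorem iInf_norm_sub_sub_le_qs11 : open Literature.Geometry.Lorentzian in ∀ {N : ℕ}, 0 < N → ∀ {y : E3} {ξ ξ' : Fin N → E3} {K : ℝ}, (∀ i, ‖ξ i - ξ' i‖ ≤ K) → (⨅ i, ‖y - ξ' i‖) - K ≤ ⨅ i, ‖y - ξ i‖ :=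
  fun hN _ _ _ _ h ↦ SublinearIsFree.TrueFieldQS.iInf_norm_sub_sub_le hN h

end Summit.FinalStateConjecture.FinalStateConjecture.Theorems

end
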